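import Mathlib
import HarnessLib

/-!
# Domination along cosets: comparing a measure with a convolution `ρ ∗ η_K` on the right-`K`-invariant sets (the "subgroup algorithm" as an inequality), and the Suslin transfer from the orbit map

HONEST FRAMING: exact (Metropolis-corrected) sampling algorithms for lattice gauge theory;
figures of merit are autocorrelation/cost numbers at stated couplings and volumes; no
continuum-physics claim.

Venture `LatticeQCDFlow` (cell pub-lqcd), topic `Exactness`, FANOUT row 9 (eng-latcore, the
engine `latflow.core`).  NEW WORK of the cell over Mathlib (`Measure.mconv`, the layer-cake
formula `lintegral_eq_lintegral_meas_lt`, Suslin's theorem `AnalyticSet.measurableSet_of_compl`,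
`MeasurableSet.analyticSet_image`); nothing is cited as a fact.  Printed counterparts, NAMED ONLY:
Diaconis–Shahshahani 1987 (the subgroup algorithm: a uniform coset representative times a
Haar-distributed subgroup element is Haar-distributed); Kechris, *Classical Descriptive Set Theory*
§14 (Suslin); the use here — an INEQUALITY version sufficient for Doeblin minorisation of the
SU(N) Cabibbo–Marinari heat bath — is the cell's.

This is the state-space-free half of the proof that the convolution of the SU(2)-pair Haar
measures dominates Haar on `SU(N)` (row 9, files `ComplexSphereAction.lean` ff.).

## What is proved (`G` a measurable group)

* §1 bookkeeping for Mathlib's convolution of measures `μ ∗ₘ ν` (law of `x y`, `x ∼ μ`, `y ∼ ν`):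
  `mconv_apply` (`(μ ∗ₘ ν)(A) = ∫ ν{y | x y ∈ A} dμ(x)`), `mconv_mono`, `mconv_smul_right`,
  `measurable_mulPreimage`.
* §2 **`le_smul_mconv_of_le_on_invariant`** (the coset lemma).  Let `K ⊆ G`, `η` a probability law
  that is invariant under LEFT multiplication by every `k ∈ K`, `ρ₁` with `ρ₁ ∗ₘ η = ρ₁`, and
  suppose `ρ₁(B) ≤ C ρ₂(B)` for every measurable `B` with `B K ⊆ B`.  Then `ρ₁ ≤ C • (ρ₂ ∗ₘ η)`.
  (Proof: `ρ₁(A) = (ρ₁ ∗ₘ η)(A) = ∫ F_A dρ₁` with `F_A(x) = η{y | xy ∈ A}` right-`K`-invariant, so its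
  super-level sets are right-`K`-invariant; layer cake.)  For the use: `ρ₁ = ` Haar of a compact
  group `H ⊇ K`, `η = ` Haar of `K`, `ρ₂` any law whose image on `H/K` dominates the invariant one.
* §3 **`exists_measurableSet_inter_eq_preimage`** (Suslin transfer).  `G` Polish, `π : G → Y`
  continuous into a Polish space, `L ⊆ G` compact with the fibre property
  `x, y ∈ L, π x = π y ⇒ x⁻¹ y ∈ K`: every measurable right-`K`-invariant `B` satisfies
  `L ∩ B = L ∩ π⁻¹(E)` for a MEASURABLE `E ⊆ Y` (`E = π(L ∩ B)` is analytic with analytic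
  complement `π(L ∖ B) ∪ (π L)ᶜ`).  Hence **`le_on_invariant_of_map_le`**: for laws `ρ₁, ρ₂` carried
  by `L`, `ρ₁.map π ≤ C • ρ₂.map π` implies `ρ₁(B) ≤ C ρ₂(B)` on right-`K`-invariant sets — the
  hypothesis of §2 from a comparison of ORBIT LAWS.

NOT CLAIMED: any equality version (the subgroup algorithm proper), disintegration, quotients `G/K`
as spaces.
-/

namespace Summit.Ventures.LatticeQCDFlow.Exactness

open MeasureTheory Measure Set
open scoped ENNReal

/-! ## §1 Convolution bookkeeping -/

section Conv

variable {G : Type*} [Group G] [MeasurableSpace G] [MeasurableMul₂ G]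

/-- The set `{y | x y ∈ A}` is measurable, jointly: `{(x, y) | x y ∈ A}` is measurable. -/
theorem measurableSet_mulMem {A : Set G} (hA : MeasurableSet A) :
    MeasurableSet {p : G × G | p.1 * p.2 ∈ A} := measurable_mul hA

/-- `x ↦ ν {y | x y ∈ A}` is measurable. -/
theorem measurable_measure_mulPreimage (ν : Measure G) [SFinite ν] {A : Set G} (hA : MeasurableSet A) :
    Measurable fun x : G => ν ((fun y => x * y) ⁻¹' A) :=
  measurable_measure_prodMk_left (measurableSet_mulMem hA)

/-- **`(μ ∗ₘ ν)(A) = ∫ ν{y | x y ∈ A} dμ(x)`.** -/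
theorem mconv_apply (μ ν : Measure G) [SFinite ν] {A : Set G} (hA : MeasurableSet A) :
    (μ ∗ₘ ν) A = ∫⁻ x, ν ((fun y => x * y) ⁻¹' A) ∂μ := by
  rw [← lintegral_indicator_one hA, lintegral_mconv (measurable_one.indicator hA)]
  refine lintegral_congr fun x => ?_
  rw [← lintegral_indicator_one (measurable_const_mul x hA)]
  rfl

/-- Convolution is monotone in both arguments. -/
theorem mconv_mono {μ μ' ν ν' : Measure G} [SFinite ν] [SFinite ν'] (hμ : μ ≤ μ') (hν : ν ≤ ν') :
    μ ∗ₘ ν ≤ μ' ∗ₘ ν' := by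
  refine Measure.le_iff.2 fun A hA => ?_
  rw [mconv_apply μ ν hA, mconv_apply μ' ν' hA]
  exact (lintegral_mono fun x => Measure.le_iff'.1 hν _).trans (lintegral_mono' hμ le_rfl)

omit [MeasurableMul₂ G] in
/-- Scalars come out of the right argument. -/
theorem mconv_smul_right (μ ν : Measure G) [SFinite μ] [SFinite ν] (c : ℝ≥0∞) :
    μ ∗ₘ (c • ν) = c • (μ ∗ₘ ν) := by
  unfold Measure.mconv
  rw [Measure.prod_smul_right, Measure.map_smul]

end Conv

/-! ## §2 The coset lemma -/

section Coset

variable {G : Type*} [Group G] [MeasurableSpace G] [MeasurableMul₂ G]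

/-- `F_A(x) = η{y | x y ∈ A}` is invariant under right multiplication by `k` whenever `η` is
invariant under left multiplication by `k`. -/
theorem measure_mulPreimage_mul_right {η : Measure G} {k : G}
    (hk : η.map (fun y => k * y) = η) (x : G) {A : Set G} (hA : MeasurableSet A) :
    η ((fun y => (x * k) * y) ⁻¹' A) = η ((fun y => x * y) ⁻¹' A) := by
  have h : (fun y => (x * k) * y) ⁻¹' A = (fun y => k * y) ⁻¹' ((fun y => x * y) ⁻¹' A) := by
    ext y; simp [mul_assoc]
  rw [h, ← Measure.map_apply (measurable_const_mul k) (measurable_const_mul x hA), hk]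

omit [Group G] [MeasurableMul₂ G] in
/-- Layer cake for a measurable `F ≤ 1`: `∫ F dρ = ∫_{t > 0} ρ{t < F} dt` (real form). -/
theorem lintegral_eq_lintegral_meas_lt_of_le_one (ρ : Measure G) {F : G → ℝ≥0∞} (hF : Measurable F)
    (hF1 : ∀ x, F x ≤ 1) :
    ∫⁻ x, F x ∂ρ = ∫⁻ t in Ioi (0 : ℝ), ρ {x | t < (F x).toReal} := by
  have hfin : ∀ x, F x ≠ ∞ := fun x => ne_top_of_le_ne_top ENNReal.one_ne_top (hF1 x)
  have h1 : ∫⁻ x, F x ∂ρ = ∫⁻ x, ENNReal.ofReal (F x).toReal ∂ρ :=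
    lintegral_congr fun x => (ENNReal.ofReal_toReal (hfin x)).symm
  rw [h1]
  exact lintegral_eq_lintegral_meas_lt ρ (Filter.Eventually.of_forall fun x => ENNReal.toReal_nonneg)
    hF.ennreal_toReal.aemeasurable

/-- **The coset lemma.**  Let `K ⊆ G`; `η` a probability law invariant under left multiplication
by every element of `K`; `ρ₁` with `ρ₁ ∗ₘ η = ρ₁`; and suppose `ρ₁(B) ≤ C ρ₂(B)` for every
measurable `B` that is invariant under right multiplication by `K`.  Then `ρ₁ ≤ C • (ρ₂ ∗ₘ η)`. -/
theorem le_smul_mconv_of_le_on_invariant {K : Set G} {η ρ₁ ρ₂ : Measure G} [IsProbabilityMeasure η]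
    [SFinite ρ₁] [SFinite ρ₂] (hη : ∀ k ∈ K, η.map (fun y => k * y) = η) (hρ₁ : ρ₁ ∗ₘ η = ρ₁)
    {C : ℝ≥0∞}
    (hdom : ∀ B : Set G, MeasurableSet B → (∀ x ∈ B, ∀ k ∈ K, x * k ∈ B) → ρ₁ B ≤ C * ρ₂ B) :
    ρ₁ ≤ C • (ρ₂ ∗ₘ η) := by
  refine Measure.le_iff.2 fun A hA => ?_
  -- `F_A` and its properties
  set F : G → ℝ≥0∞ := fun x => η ((fun y => x * y) ⁻¹' A) with hF
  have hFm : Measurable F := measurable_measure_mulPreimage η hA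
  have hF1 : ∀ x, F x ≤ 1 := fun x => prob_le_one
  have hFinv : ∀ x, ∀ k ∈ K, F (x * k) = F x := fun x k hk =>
    measure_mulPreimage_mul_right (hη k hk) x hA
  -- super-level sets are right-`K`-invariant
  have hlev : ∀ t : ℝ, ρ₁ {x | t < (F x).toReal} ≤ C * ρ₂ {x | t < (F x).toReal} := fun t =>
    hdom _ (measurableSet_lt measurable_const hFm.ennreal_toReal) fun x hx k hk => by
      change t < (F (x * k)).toReal
      rw [hFinv x k hk]; exact hx
  rw [Measure.smul_apply, smul_eq_mul, ← hρ₁, mconv_apply ρ₁ η hA, mconv_apply ρ₂ η hA]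
  change ∫⁻ x, F x ∂ρ₁ ≤ C * ∫⁻ x, F x ∂ρ₂
  have hanti : Antitone fun t : ℝ => ρ₂ {x | t < (F x).toReal} := fun t t' htt' =>
    measure_mono fun x hx => lt_of_le_of_lt htt' hx
  rw [lintegral_eq_lintegral_meas_lt_of_le_one ρ₁ hFm hF1,
    lintegral_eq_lintegral_meas_lt_of_le_one ρ₂ hFm hF1, ← lintegral_const_mul C hanti.measurable]
  exact setLIntegral_mono' measurableSet_Ioi fun t _ => hlev t

end Coset

/-! ## §3 The Suslin transfer: right-invariant sets are pulled back from the orbit space -/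

section Suslin

variable {G : Type*} [Group G] [TopologicalSpace G] [PolishSpace G] [MeasurableSpace G] [BorelSpace G]
  {Y : Type*} [TopologicalSpace Y] [PolishSpace Y] [MeasurableSpace Y] [BorelSpace Y]

/-- **Suslin transfer.**  Let `π : G → Y` be continuous, `L ⊆ G` compact with the fibre property
`x, y ∈ L, π x = π y ⇒ x⁻¹ y ∈ K`.  Then for every measurable `B` invariant under right
multiplication by `K` there is a MEASURABLE `E ⊆ Y` with `L ∩ B = L ∩ π⁻¹(E)`: one may take
`E = π(L ∩ B)`, analytic with analytic complement `π(L ∖ B) ∪ (π L)ᶜ`, hence Borel (Suslin). -/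
theorem exists_measurableSet_inter_eq_preimage {K L B : Set G} {π : G → Y} (hπ : Continuous π)
    (hL : IsCompact L) (hfib : ∀ x ∈ L, ∀ y ∈ L, π x = π y → x⁻¹ * y ∈ K)
    (hB : MeasurableSet B) (hBK : ∀ x ∈ B, ∀ k ∈ K, x * k ∈ B) :
    ∃ E : Set Y, MeasurableSet E ∧ L ∩ B = L ∩ π ⁻¹' E := by
  have hLm : MeasurableSet L := hL.isClosed.measurableSet
  -- if `x ∈ L ∩ B` and `y ∈ L` lie over the same point then `y ∈ B`
  have key : ∀ x ∈ L, x ∈ B → ∀ y ∈ L, π x = π y → y ∈ B := fun x hxL hxB y hyL hxy => by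
    have h := hBK x hxB _ (hfib x hxL y hyL hxy)
    rwa [mul_inv_cancel_left] at h
  refine ⟨π '' (L ∩ B), ?_, ?_⟩
  · have hA : AnalyticSet (π '' (L ∩ B)) := (hLm.inter hB).analyticSet_image hπ.measurable
    have heq : (π '' (L ∩ B))ᶜ = π '' (L \ B) ∪ (π '' L)ᶜ := by
      ext y
      constructor
      · intro hy
        by_cases hyL : y ∈ π '' L
        · obtain ⟨x, hxL, rfl⟩ := hyL
          have hxB : x ∉ B := fun hxB => hy ⟨x, ⟨hxL, hxB⟩, rfl⟩
          exact Or.inl ⟨x, ⟨hxL, hxB⟩, rfl⟩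
        · exact Or.inr hyL
      · rintro (⟨x, ⟨hxL, hxB⟩, rfl⟩ | hy)
        · rintro ⟨x', ⟨hx'L, hx'B⟩, hxx'⟩
          exact hxB (key x' hx'L hx'B x hxL hxx')
        · rintro ⟨x, ⟨hxL, -⟩, hxy⟩
          exact hy ⟨x, hxL, hxy⟩
    have hAc : AnalyticSet (π '' (L ∩ B))ᶜ := by
      rw [heq, union_eq_iUnion]
      refine AnalyticSet.iUnion fun b => ?_
      cases b
      · exact ((hL.image hπ).isClosed.isOpen_compl.measurableSet).analyticSet
      · exact (hLm.diff hB).analyticSet_image hπ.measurable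
    exact hA.measurableSet_of_compl hAc
  · ext y
    constructor
    · rintro ⟨hyL, hyB⟩
      exact ⟨hyL, y, ⟨hyL, hyB⟩, rfl⟩
    · rintro ⟨hyL, x, ⟨hxL, hxB⟩, hxy⟩
      exact ⟨hyL, key x hxL hxB y hyL hxy⟩

/-- **Domination on right-`K`-invariant sets from domination of the orbit laws.**  In the setting of
`exists_measurableSet_inter_eq_preimage`, if `ρ₁`, `ρ₂` are carried by `L` and
`ρ₁.map π ≤ C • ρ₂.map π`, then `ρ₁(B) ≤ C ρ₂(B)` for every measurable right-`K`-invariant `B`. -/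
theorem le_on_invariant_of_map_le {K L : Set G} {π : G → Y} (hπ : Continuous π) (hL : IsCompact L)
    (hfib : ∀ x ∈ L, ∀ y ∈ L, π x = π y → x⁻¹ * y ∈ K) {ρ₁ ρ₂ : Measure G} (h₁ : ρ₁ Lᶜ = 0)
    (h₂ : ρ₂ Lᶜ = 0) {C : ℝ≥0∞} (hmap : ρ₁.map π ≤ C • ρ₂.map π) {B : Set G}
    (hB : MeasurableSet B) (hBK : ∀ x ∈ B, ∀ k ∈ K, x * k ∈ B) : ρ₁ B ≤ C * ρ₂ B := by
  obtain ⟨E, hE, hLB⟩ := exists_measurableSet_inter_eq_preimage hπ hL hfib hB hBK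
  have hswap : ∀ ρ : Measure G, ρ Lᶜ = 0 → ρ B = (ρ.map π) E := fun ρ hρ => by
    rw [Measure.map_apply hπ.measurable hE, ← measure_inter_conull hρ, inter_comm, hLB, inter_comm,
      measure_inter_conull hρ]
  rw [hswap ρ₁ h₁, hswap ρ₂ h₂]
  have h := Measure.le_iff'.1 hmap E
  rwa [Measure.smul_apply, smul_eq_mul] at h

end Suslin

end Summit.Ventures.LatticeQCDFlow.Exactness
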